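import Summits.AnomalousDissipation.AnomalousDissipation.Theorems.MomentParityMomentLadderLine
import Summits.AnomalousDissipation.AnomalousDissipation.Theorems.CubicParityLoud.Negative.Clauses

/-!
# Stub `stub_truncatedPalinstrophy` for line `enstrophy-ui-level-ledger`
# (crux `MomentParity.ResolvedDissipation`, stmt-AnomalousDissipation-14284)

The level-truncated Foias–Guillopé–Temam bound (stub S2 of the line): for every `(f, ν > 0, R)` and every
enstrophy level `Λ` there is `C = C(f, ν, R, Λ)` such that EVERY admissible law `μ` at EVERY Galerkin level `N`
(probability, carried by level-`N` fields, supported in `‖u‖ ≤ R`, polynomially stationary at every degree)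
has `∫_{Z ≤ Λ} ‖Δu‖² dμ ≤ C`, where `Z = ‖∇u‖²` — bounded-enstrophy strata have `N`-uniformly bounded mean
palinstrophy.

Proof: a THIN COROLLARY of the landed `N`-uniform WEIGHTED palinstrophy bound of the `MomentLadder` line
(`MomentLadder.stub_weightedPalinstrophyBound` fed `stub_stokesTruncRow`, `stub_weightStationarity`,
`stub_enstrophyTestField`; FMRT 2001 Ch. II App. B (B.9)–(B.11) at Galerkin level):
`∫ ‖Δu‖²/(1+Z)² dμ ≤ C₀(f, ν, R) < ∞`. On the stratum `{Z ≤ Λ}` the weight is bounded below,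
`‖Δu‖² = (1+Z)² · ‖Δu‖²/(1+Z)² ≤ (1+Λ)² · ‖Δu‖²/(1+Z)²`, so `∫_{Z ≤ Λ} ‖Δu‖² dμ ≤ (1+Λ)² C₀ =: C`.
The first hypothesis of the registered signature (the stretching bound S1, through which the planner
intended the direct FGT argument) is therefore not used.
-/

noncomputable section

-- `Summit.<Summit>.<Problem>`: single-conjunct summit, the duplicate namespace segment is mandated.
set_option linter.dupNamespace false

namespace Summit.AnomalousDissipation.AnomalousDissipation.Theorems.MomentParityResolvedDissipation.TruncatedPalinstrophy

open MeasureTheory Filter Topology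
open scoped ENNReal InnerProductSpace RealInnerProductSpace
open Literature.Analysis.FunctionSpaces Literature.Analysis.FluidPDE
open Summit.AnomalousDissipation.AnomalousDissipation.Theses.MomentParity
open Summit.AnomalousDissipation.AnomalousDissipation.Theorems.CubicParityLoud.Negative (T3 R3 H3)
open Summit.AnomalousDissipation.AnomalousDissipation.Theorems.QuarticGate.Negative
  (IsLevel IsBandTest polyGrad IsPolyStationary)

/-- **Pointwise step**: on the bounded-enstrophy stratum `{Z ≤ Λ}` the palinstrophy is dominated by the
weighted palinstrophy, `‖Δu‖² ≤ (1 + Λ)² · ‖Δu‖²/(1+Z)²` (in `ℝ≥0∞`; `Z ≤ ofReal Λ < ∞` makes the weight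
`(1+Z)²` finite and non-zero, so `‖Δu‖² = (1+Z)² · (‖Δu‖²/(1+Z)²)`). [folklore] -/
theorem eLaplacianNormSq_le_weighted_of_le {Λ : ℝ} {u : H3}
    (hu : Torus.eGradNormSq (u.1 : T3 → R3) ≤ ENNReal.ofReal Λ) :
    eLaplacianNormSq (u.1 : T3 → R3) ≤ (1 + ENNReal.ofReal Λ) ^ 2 *
      (eLaplacianNormSq (u.1 : T3 → R3) / (1 + Torus.eGradNormSq (u.1 : T3 → R3)) ^ 2) := by
  have hZT : Torus.eGradNormSq (u.1 : T3 → R3) ≠ ⊤ := ne_top_of_le_ne_top ENNReal.ofReal_ne_top hu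
  have hB0 : (1 + Torus.eGradNormSq (u.1 : T3 → R3)) ^ 2 ≠ 0 := pow_ne_zero _ (by simp)
  have hBT : (1 + Torus.eGradNormSq (u.1 : T3 → R3)) ^ 2 ≠ ⊤ :=
    ENNReal.pow_ne_top (ENNReal.add_ne_top.2 ⟨ENNReal.one_ne_top, hZT⟩)
  calc eLaplacianNormSq (u.1 : T3 → R3) = (1 + Torus.eGradNormSq (u.1 : T3 → R3)) ^ 2 *
        (eLaplacianNormSq (u.1 : T3 → R3) / (1 + Torus.eGradNormSq (u.1 : T3 → R3)) ^ 2) :=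
        (ENNReal.mul_div_cancel hB0 hBT).symm
    _ ≤ (1 + ENNReal.ofReal Λ) ^ 2 *
        (eLaplacianNormSq (u.1 : T3 → R3) / (1 + Torus.eGradNormSq (u.1 : T3 → R3)) ^ 2) :=
        mul_le_mul' (pow_le_pow_left' (add_le_add le_rfl hu) 2) le_rfl

/-- **Integrated step**: for every law `μ` on `H` and every level `Λ`,
`∫_{Z ≤ Λ} ‖Δu‖² dμ ≤ (1 + Λ)² ∫ ‖Δu‖²/(1+Z)² dμ` (pointwise step on the measurable stratum, then drop the
restriction). [folklore] -/
theorem setLIntegral_eLaplacianNormSq_le_weighted (Λ : ℝ) (μ : Measure H3) :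
    ∫⁻ u in {u : H3 | Torus.eGradNormSq (u.1 : T3 → R3) ≤ ENNReal.ofReal Λ},
        eLaplacianNormSq (u.1 : T3 → R3) ∂μ ≤
      (1 + ENNReal.ofReal Λ) ^ 2 *
        ∫⁻ u, eLaplacianNormSq (u.1 : T3 → R3) / (1 + Torus.eGradNormSq (u.1 : T3 → R3)) ^ 2 ∂μ := by
  have hAT : (1 + ENNReal.ofReal Λ) ^ 2 ≠ ⊤ :=
    ENNReal.pow_ne_top (ENNReal.add_ne_top.2 ⟨ENNReal.one_ne_top, ENNReal.ofReal_ne_top⟩)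
  have hS : MeasurableSet {u : H3 | Torus.eGradNormSq (u.1 : T3 → R3) ≤ ENNReal.ofReal Λ} :=
    measurableSet_le Torus.measurable_eGradNormSq_coe measurable_const
  calc ∫⁻ u in {u : H3 | Torus.eGradNormSq (u.1 : T3 → R3) ≤ ENNReal.ofReal Λ},
          eLaplacianNormSq (u.1 : T3 → R3) ∂μ
      ≤ ∫⁻ u in {u : H3 | Torus.eGradNormSq (u.1 : T3 → R3) ≤ ENNReal.ofReal Λ},
          (1 + ENNReal.ofReal Λ) ^ 2 *
            (eLaplacianNormSq (u.1 : T3 → R3) / (1 + Torus.eGradNormSq (u.1 : T3 → R3)) ^ 2) ∂μ :=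
        setLIntegral_mono' hS fun u hu => eLaplacianNormSq_le_weighted_of_le hu
    _ = (1 + ENNReal.ofReal Λ) ^ 2 *
          ∫⁻ u in {u : H3 | Torus.eGradNormSq (u.1 : T3 → R3) ≤ ENNReal.ofReal Λ},
            eLaplacianNormSq (u.1 : T3 → R3) / (1 + Torus.eGradNormSq (u.1 : T3 → R3)) ^ 2 ∂μ :=
        lintegral_const_mul' _ _ hAT
    _ ≤ (1 + ENNReal.ofReal Λ) ^ 2 *
          ∫⁻ u, eLaplacianNormSq (u.1 : T3 → R3) / (1 + Torus.eGradNormSq (u.1 : T3 → R3)) ^ 2 ∂μ :=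
        mul_le_mul' le_rfl (setLIntegral_le_lintegral _ _)

/-- **S2 · `stub_truncatedPalinstrophy` (level-truncated Foias–Guillopé–Temam bound).** For every
`(f, ν > 0, R)` and every enstrophy level `Λ` there is `C = C(f, ν, R, Λ)` such that EVERY admissible law at
EVERY level `N` has `∫_{Z ≤ Λ} ‖Δu‖² dμ ≤ C` — bounded-enstrophy strata are resolved uniformly in `N`.
Here `C = ((1 + Λ)² C₀)`, `C₀ = C₀(f, ν, R) < ∞` the landed `N`-uniform weighted palinstrophy bound
`∫ ‖Δu‖²/(1+Z)² dμ ≤ C₀` (`MomentLadder.stub_weightedPalinstrophyBound`); the stretching-bound hypothesis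
(stub S1) is not needed for this route and is discarded. [cite: FMRTTurbulence2001, Ch. II App. B (B.9)–(B.11);
Ch. IV Prop. 3.3 (3.6)] -/
theorem stub_truncatedPalinstrophy :
    (∃ c : ℝ, 0 ≤ c ∧ ∀ (N : ℕ) (u : H3), IsLevel N u → ∀ w : T3 → R3, Torus.IsSmooth w →
      |Torus.inertialPairing u.1 w| ≤
        c * (Torus.eGradNormSq (u.1 : T3 → R3)).toReal ^ (3 / 4 : ℝ) *
          (eLaplacianNormSq (u.1 : T3 → R3)).toReal ^ (1 / 4 : ℝ) *
            (∫ x, ‖w x‖ ^ 2) ^ (1 / 2 : ℝ)) →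
    ∀ f : T3 → R3, Torus.IsSmooth f → Torus.IsDivFree f → Torus.HasZeroMean f →
    ∀ ν : ℝ, 0 < ν → ∀ R Λ : ℝ, ∃ C : ℝ, ∀ (N : ℕ) (μ : Measure H3), IsProbabilityMeasure μ →
      (∀ᵐ u ∂μ, IsLevel N u) → (∀ᵐ u ∂μ, ‖u‖ ≤ R) → (∀ d : ℕ, IsPolyStationary ν f N d μ) →
      ∫⁻ u in {u : H3 | Torus.eGradNormSq (u.1 : T3 → R3) ≤ ENNReal.ofReal Λ},
          eLaplacianNormSq (u.1 : T3 → R3) ∂μ ≤ ENNReal.ofReal C := by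
  intro _ f hfs _ _ ν hν R Λ
  -- the landed `N`-uniform weighted palinstrophy bound of the `MomentLadder` line
  obtain ⟨C₀, hC₀T, hC₀⟩ := MomentLadder.stub_weightedPalinstrophyBound MomentLadder.stub_stokesTruncRow
    (MomentLadder.stub_weightStationarity MomentLadder.stub_enstrophyTestField) f hfs ν hν R
  have hAT : (1 + ENNReal.ofReal Λ) ^ 2 ≠ ⊤ :=
    ENNReal.pow_ne_top (ENNReal.add_ne_top.2 ⟨ENNReal.one_ne_top, ENNReal.ofReal_ne_top⟩)
  refine ⟨((1 + ENNReal.ofReal Λ) ^ 2 * C₀).toReal, fun N μ hP hlev hsupp hstat => ?_⟩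
  rw [ENNReal.ofReal_toReal (ENNReal.mul_ne_top hAT hC₀T.ne)]
  exact (setLIntegral_eLaplacianNormSq_le_weighted Λ μ).trans
    (mul_le_mul' le_rfl (hC₀ N μ hP hlev hsupp hstat))

end Summit.AnomalousDissipation.AnomalousDissipation.Theorems.MomentParityResolvedDissipation.TruncatedPalinstrophy

end
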